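import Summits.Ventures.HodgeRepro.FaceCensusEngine
import Summits.Ventures.HodgeRepro.EngineMasks
import Summits.Ventures.HodgeRepro.EngineFacesWF
import Summits.Ventures.HodgeRepro.EngineNormalize
import Summits.Ventures.HodgeRepro.EngineOrbits
import Summits.Ventures.HodgeRepro.EngineCounts
import Summits.Ventures.HodgeRepro.EngineTypes

/-!
# EngineSquares — every type square comes from exactly 8 faces, so `faces.length = 8 * squares.length` (seat p4)

The square of the face `(T; p, q)` is the coset `T ⊕ {0, p, q, p ⊕ q}` of the Klein four-group generated by
the two flips; its 8 faces are its 4 members with the two orderings of `{p, q}`.  With `faces_length` and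
`cmTypes_length` this gives the closed formula `squares.length = 2^{n/2} · (n/2)(n/2 − 1) / 8` for every
Galois CM type (6 / 24 / 240 for n = 6 / 8 / 12).  (Part 7 of p4's generic engine lemmas.)  The Klein list
of a square is written out as `[0, p, q, p ^^^ q]` and its eight faces as the `flatMap` over it (kit v4: no auxiliary
definitions, every file of the kit is a pure proof file).
-/

namespace Summit.Ventures.HodgeRepro.FaceCensus

namespace CMGaloisType

variable {n : ℕ} (Γ : CMGaloisType n)

/-! ### Places are nonzero and never the xor of two distinct places -/

/-- A place mask is nonzero. -/
theorem placeMask_ne_zero (a : Fin n) : Γ.placeMask a ≠ 0 := by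
  intro h
  have := Γ.mem_placeMask_self a
  rw [h, mem_zero] at this
  exact Bool.false_ne_true this

/-- For two distinct places the `xor` of their masks is their union, bitwise. -/
theorem mem_xor_places (hΓ : Γ.isCMGaloisType = true) {b c : Fin n} (hbc : Γ.placeMask b ≠ Γ.placeMask c) (i : Fin n) :
    mem i (Γ.placeMask b ^^^ Γ.placeMask c) = (mem i (Γ.placeMask b) || mem i (Γ.placeMask c)) := by
  rw [mem_xor]
  cases hb : mem i (Γ.placeMask b) <;> cases hc : mem i (Γ.placeMask c) <;> simp
  exact Γ.not_mem_both_places hΓ hbc hb hc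

/-- A place is never the `xor` of two distinct places. -/
theorem placeMask_ne_xor (hΓ : Γ.isCMGaloisType = true) {a b c : Fin n} (hbc : Γ.placeMask b ≠ Γ.placeMask c) :
    Γ.placeMask a ≠ Γ.placeMask b ^^^ Γ.placeMask c := by
  intro h
  have hb : mem b (Γ.placeMask a) = true := by
    rw [h, Γ.mem_xor_places hΓ hbc, Γ.mem_placeMask_self]; rfl
  have hcb : mem (Γ.mul Γ.conj b) (Γ.placeMask a) = true := by
    rw [h, Γ.mem_xor_places hΓ hbc, Γ.mem_conj_placeMask hΓ, Γ.mem_placeMask_self]; rfl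
  have hc : mem c (Γ.placeMask a) = true := by
    rw [h, Γ.mem_xor_places hΓ hbc, Γ.mem_placeMask_self]; simp
  rw [Γ.mem_placeMask, Bool.or_eq_true, decide_eq_true_eq, decide_eq_true_eq] at hb hcb hc
  -- `b`, `c b`, `c` all lie in `{a, c a}`, but `b ≠ c b` and `c ∉ {b, c b}`
  have hc' : c = b ∨ c = Γ.mul Γ.conj b := by
    rcases hb with hb | hb
    · rcases hcb with hcb | hcb
      · exact ((IsGroupTable.conj_mul_ne hΓ) b (hcb.trans hb.symm)).elim
      · rcases hc with hc | hc
        · exact Or.inl (hc.trans hb.symm)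
        · exact Or.inr (hc.trans hcb.symm)
    · rcases hcb with hcb | hcb
      · rcases hc with hc | hc
        · exact Or.inr (hc.trans hcb.symm)
        · exact Or.inl (hc.trans hb.symm)
      · exact ((IsGroupTable.conj_mul_ne hΓ) b (hcb.trans hb.symm)).elim
  apply hbc
  rcases hc' with rfl | rfl
  · rfl
  · exact (Γ.placeMask_conj hΓ b).symm

/-! ### The Klein four-group of a face -/

/-- Membership in the Klein list `[0, p, q, p ^^^ q] = [0, p, q, p ^^^ q]`. -/
theorem mem_klein (p q u : ℕ) : u ∈ [0, p, q, p ^^^ q] ↔ u = 0 ∨ u = p ∨ u = q ∨ u = p ^^^ q := by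
  simp

/-- `[0, p, q, p ^^^ q]` is closed under `xor` (it is the Klein four-group generated by `p` and `q`). -/
theorem xor_mem_klein {p q u v : ℕ} (hu : u ∈ [0, p, q, p ^^^ q]) (hv : v ∈ [0, p, q, p ^^^ q]) : u ^^^ v ∈ [0, p, q, p ^^^ q] := by
  rw [mem_klein] at hu hv ⊢
  rcases hu with rfl | rfl | rfl | rfl <;> rcases hv with rfl | rfl | rfl | rfl <;>
    simp [Nat.xor_comm, Nat.xor_left_comm]

/-- The square of `(T; p, q)` is the coset `T ⊕ [0, p, q, p ^^^ q]`. -/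
theorem mem_square_iff_klein (T p q x : ℕ) : x ∈ square (T, p, q) ↔ ∃ u ∈ [0, p, q, p ^^^ q], x = T ^^^ u := by
  rw [mem_square]
  simp only [flipAt, mem_klein]
  constructor
  · rintro (h | h | h | h)
    · exact ⟨0, Or.inl rfl, by rw [h, Nat.xor_zero]⟩
    · exact ⟨p, Or.inr (Or.inl rfl), h⟩
    · exact ⟨q, Or.inr (Or.inr (Or.inl rfl)), h⟩
    · exact ⟨p ^^^ q, Or.inr (Or.inr (Or.inr rfl)), by rw [h, Nat.xor_assoc]⟩
  · rintro ⟨u, (rfl | rfl | rfl | rfl), rfl⟩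
    · exact Or.inl (Nat.xor_zero T)
    · exact Or.inr (Or.inl rfl)
    · exact Or.inr (Or.inr (Or.inl rfl))
    · exact Or.inr (Or.inr (Or.inr (Nat.xor_assoc T p q).symm))

/-- A shifted face `(T ⊕ u; p', q')` with `u` in the Klein group and `{p', q'} = {p, q}` has the same square. -/
theorem square_shift (T p q u : ℕ) (hu : u ∈ [0, p, q, p ^^^ q]) :
    square (T ^^^ u, p, q) = square (T, p, q) ∧ square (T ^^^ u, q, p) = square (T, p, q) := by
  have key : ∀ x, x ∈ square (T ^^^ u, p, q) ↔ x ∈ square (T, p, q) := by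
    intro x
    rw [mem_square_iff_klein, mem_square_iff_klein]
    constructor
    · rintro ⟨v, hv, rfl⟩
      exact ⟨u ^^^ v, xor_mem_klein hu hv, Nat.xor_assoc T u v⟩
    · rintro ⟨v, hv, rfl⟩
      exact ⟨u ^^^ v, xor_mem_klein hu hv, by rw [Nat.xor_assoc, ← Nat.xor_assoc u u v, Nat.xor_self, Nat.zero_xor]⟩
  have key' : ∀ x, x ∈ square (T ^^^ u, q, p) ↔ x ∈ square (T ^^^ u, p, q) := by
    intro x
    rw [mem_square_iff_klein, mem_square_iff_klein]
    simp only [mem_klein]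
    simp only [Nat.xor_comm q p]
    constructor
    · rintro ⟨v, hv, rfl⟩
      exact ⟨v, by tauto, rfl⟩
    · rintro ⟨v, hv, rfl⟩
      exact ⟨v, by tauto, rfl⟩
  refine ⟨?_, ?_⟩
  · exact (normalize_pairwise_lt _).eq_of_mem_iff (normalize_pairwise_lt _) key
  · exact (normalize_pairwise_lt _).eq_of_mem_iff (normalize_pairwise_lt _) fun x => (key' x).trans (key x)

/-- Membership in `([0, p, q, p ^^^ q].flatMap fun u => [(T ^^^ u, p, q), (T ^^^ u, q, p)])`: the members of the coset with either ordering of `{p, q}`. -/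
theorem mem_eightFaces (T p q : ℕ) (f : ℕ × ℕ × ℕ) :
    f ∈ ([0, p, q, p ^^^ q].flatMap fun u => [(T ^^^ u, p, q), (T ^^^ u, q, p)]) ↔ ∃ u ∈ [0, p, q, p ^^^ q], f = (T ^^^ u, p, q) ∨ f = (T ^^^ u, q, p) := by
  simp [or_assoc]

/-- Characterisation of the fibre: a face has the same square as `(T; p, q)` iff it is one of the eight. -/
theorem square_eq_iff_mem_eightFaces (hΓ : Γ.isCMGaloisType = true) {T p q : ℕ} (hf : (T, p, q) ∈ Γ.faces)
    (g : ℕ × ℕ × ℕ) (hg : g ∈ Γ.faces) : square g = square (T, p, q) ↔ g ∈ ([0, p, q, p ^^^ q].flatMap fun u => [(T ^^^ u, p, q), (T ^^^ u, q, p)]) := by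
  obtain ⟨X, p', q'⟩ := g
  rw [Γ.mem_faces] at hf hg
  obtain ⟨-, hp, hq, hqp⟩ := hf
  obtain ⟨-, hp', hq', hqp'⟩ := hg
  obtain ⟨a, rfl⟩ := (Γ.mem_places p).1 hp
  obtain ⟨b, rfl⟩ := (Γ.mem_places q).1 hq
  obtain ⟨a', rfl⟩ := (Γ.mem_places p').1 hp'
  obtain ⟨b', rfl⟩ := (Γ.mem_places q').1 hq'
  constructor
  · intro h
    -- `X`, `X ⊕ p'`, `X ⊕ q'` lie in the square of `(T; p, q)`
    have hX : X ∈ square (T, Γ.placeMask a, Γ.placeMask b) := by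
      rw [← h, mem_square]; exact Or.inl rfl
    have hXp : X ^^^ Γ.placeMask a' ∈ square (T, Γ.placeMask a, Γ.placeMask b) := by
      rw [← h, mem_square]; exact Or.inr (Or.inl rfl)
    have hXq : X ^^^ Γ.placeMask b' ∈ square (T, Γ.placeMask a, Γ.placeMask b) := by
      rw [← h, mem_square]; exact Or.inr (Or.inr (Or.inl rfl))
    rw [mem_square_iff_klein] at hX hXp hXq
    obtain ⟨u, hu, rfl⟩ := hX
    obtain ⟨v, hv, hv'⟩ := hXp
    obtain ⟨w, hw, hw'⟩ := hXq
    rw [Nat.xor_assoc, Nat.xor_right_inj] at hv' hw'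
    -- hence `p' = u ⊕ v ∈ K`, `q' = u ⊕ w ∈ K`
    have hp'K : Γ.placeMask a' ∈ [0, (Γ.placeMask a), (Γ.placeMask b), (Γ.placeMask a) ^^^ (Γ.placeMask b)] := by
      have := xor_mem_klein hu (hv' ▸ hv)
      rwa [← Nat.xor_assoc, Nat.xor_self, Nat.zero_xor] at this
    have hq'K : Γ.placeMask b' ∈ [0, (Γ.placeMask a), (Γ.placeMask b), (Γ.placeMask a) ^^^ (Γ.placeMask b)] := by
      have := xor_mem_klein hu (hw' ▸ hw)
      rwa [← Nat.xor_assoc, Nat.xor_self, Nat.zero_xor] at this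
    -- a place in `K` is `p` or `q`
    have hab : Γ.placeMask a ≠ Γ.placeMask b := Ne.symm hqp
    have hmemK : ∀ c : Fin n, Γ.placeMask c ∈ [0, (Γ.placeMask a), (Γ.placeMask b), (Γ.placeMask a) ^^^ (Γ.placeMask b)] →
        Γ.placeMask c = Γ.placeMask a ∨ Γ.placeMask c = Γ.placeMask b := by
      intro c hc
      rw [mem_klein] at hc
      rcases hc with hc | hc | hc | hc
      · exact (Γ.placeMask_ne_zero c hc).elim
      · exact Or.inl hc
      · exact Or.inr hc
      · exact (Γ.placeMask_ne_xor hΓ hab hc).elim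
    rw [mem_eightFaces]
    refine ⟨u, hu, ?_⟩
    rcases hmemK a' hp'K with h1 | h1 <;> rcases hmemK b' hq'K with h2 | h2
    · exact (hqp' (h2.trans h1.symm)).elim
    · left; rw [h1, h2]
    · right; rw [h1, h2]
    · exact (hqp' (h2.trans h1.symm)).elim
  · intro h
    rw [mem_eightFaces] at h
    obtain ⟨u, hu, h | h⟩ := h
    · rw [Prod.mk.injEq, Prod.mk.injEq] at h
      obtain ⟨h1, h2, h3⟩ := h
      rw [h1, h2, h3]
      exact (square_shift T _ _ u hu).1
    · rw [Prod.mk.injEq, Prod.mk.injEq] at h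
      obtain ⟨h1, h2, h3⟩ := h
      rw [h1, h2, h3]
      exact (square_shift T _ _ u hu).2

/-! ### Counting: `faces.length = 8 * squares.length` -/

/-- `T ≠ T ^^^ u` for `u ≠ 0`. -/
theorem self_ne_xor {T u : ℕ} (h : u ≠ 0) : T ≠ T ^^^ u := by
  intro e
  apply h
  have := Nat.xor_right_inj.1 (show T ^^^ 0 = T ^^^ u by rw [Nat.xor_zero]; exact e)
  exact this.symm

/-- `T ^^^ u ≠ T ^^^ v` for `u ≠ v`. -/
theorem xor_ne_xor {T u v : ℕ} (h : u ≠ v) : T ^^^ u ≠ T ^^^ v := fun e => h (Nat.xor_right_inj.1 e)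

/-- The eight faces are pairwise distinct. -/
theorem eightFaces_nodup {T p q : ℕ} (hp : p ≠ 0) (hq : q ≠ 0) (hpq : p ≠ q) : (([0, p, q, p ^^^ q].flatMap fun u => [(T ^^^ u, p, q), (T ^^^ u, q, p)])).Nodup := by
  have hpq0 : p ^^^ q ≠ 0 := fun h => hpq (Nat.xor_right_inj.1 (h.trans (Nat.xor_self p).symm)).symm
  have hppq : p ≠ p ^^^ q := fun h => hq (by
    have := Nat.xor_right_inj.1 (show p ^^^ 0 = p ^^^ q by rw [Nat.xor_zero]; exact h)
    exact this.symm)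
  have hqpq : q ≠ p ^^^ q := fun h => hp (by
    have := Nat.xor_right_inj.1 (show q ^^^ 0 = q ^^^ p by rw [Nat.xor_zero, Nat.xor_comm]; exact h)
    exact this.symm)
  simp only [List.flatMap_cons, List.flatMap_nil, List.append_nil, List.cons_append,
    List.nil_append, Nat.xor_zero]
  simp [List.nodup_cons, Prod.ext_iff, hpq, Ne.symm hpq, self_ne_xor hp, self_ne_xor hq, self_ne_xor hpq0,
    xor_ne_xor hpq, xor_ne_xor hppq, xor_ne_xor hqpq]

/-- `([0, p, q, p ^^^ q].flatMap fun u => [(T ^^^ u, p, q), (T ^^^ u, q, p)])` has length `8`. -/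
theorem eightFaces_length (T p q : ℕ) : (([0, p, q, p ^^^ q].flatMap fun u => [(T ^^^ u, p, q), (T ^^^ u, q, p)])).length = 8 := by
  simp

/-- The eight faces of a face are faces. -/
theorem eightFaces_subset_faces (hΓ : Γ.isCMGaloisType = true) {T p q : ℕ} (hf : (T, p, q) ∈ Γ.faces) :
    ∀ g ∈ ([0, p, q, p ^^^ q].flatMap fun u => [(T ^^^ u, p, q), (T ^^^ u, q, p)]), g ∈ Γ.faces := by
  intro g hg
  rw [mem_eightFaces] at hg
  obtain ⟨u, hu, hg⟩ := hg
  have hf' := hf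
  rw [Γ.mem_faces] at hf'
  obtain ⟨hT, hp, hq, hqp⟩ := hf'
  rw [Γ.mem_cmTypes] at hT
  obtain ⟨a, rfl⟩ := (Γ.mem_places p).1 hp
  obtain ⟨b, rfl⟩ := (Γ.mem_places q).1 hq
  -- every member of the square is a CM type
  have hTu : Γ.isCMType (T ^^^ u) = true := by
    rw [mem_klein] at hu
    rcases hu with rfl | rfl | rfl | rfl
    · rw [Nat.xor_zero]; exact hT
    · exact Γ.isCMType_flipAt_placeMask hΓ hT a
    · exact Γ.isCMType_flipAt_placeMask hΓ hT b
    · rw [← Nat.xor_assoc]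
      exact Γ.isCMType_flipAt_placeMask hΓ (Γ.isCMType_flipAt_placeMask hΓ hT a) b
  rcases hg with rfl | rfl
  · exact (Γ.mem_faces _).2 ⟨(Γ.mem_cmTypes _).2 hTu, hp, hq, hqp⟩
  · exact (Γ.mem_faces _).2 ⟨(Γ.mem_cmTypes _).2 hTu, hq, hp, Ne.symm hqp⟩

/-- `faces` has no duplicates. -/
theorem faces_nodup : Γ.faces.Nodup := by
  unfold faces
  rw [List.nodup_flatMap]
  refine ⟨fun T _ => ?_, ?_⟩
  · rw [List.nodup_flatMap]
    refine ⟨fun p _ => ?_, ?_⟩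
    · exact (Γ.places_nodup.filter _).map (fun q q' h => by simpa using h)
    · refine Γ.places_nodup.imp fun {p p'} hpp' => ?_
      rw [Function.onFun, List.disjoint_left]
      intro g hg hg'
      rw [List.mem_map] at hg hg'
      obtain ⟨q, -, rfl⟩ := hg
      obtain ⟨q', -, h⟩ := hg'
      rw [Prod.mk.injEq, Prod.mk.injEq] at h
      exact hpp' h.2.1.symm
  · refine Γ.cmTypes_nodup.imp fun {T T'} hTT' => ?_
    rw [Function.onFun, List.disjoint_left]
    intro g hg hg'
    rw [List.mem_flatMap] at hg hg'
    obtain ⟨p, -, hg⟩ := hg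
    obtain ⟨p', -, hg'⟩ := hg'
    rw [List.mem_map] at hg hg'
    obtain ⟨q, -, rfl⟩ := hg
    obtain ⟨q', -, h⟩ := hg'
    rw [Prod.mk.injEq] at h
    exact hTT' h.1.symm

/-- The fibre of `square` over the square of a face has exactly 8 elements. -/
theorem length_filter_square_eq (hΓ : Γ.isCMGaloisType = true) {T p q : ℕ} (hf : (T, p, q) ∈ Γ.faces) :
    (Γ.faces.filter fun g => decide (square g = square (T, p, q))).length = 8 := by
  have hf' := hf
  rw [Γ.mem_faces] at hf'
  obtain ⟨-, hp, hq, hqp⟩ := hf'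
  obtain ⟨a, rfl⟩ := (Γ.mem_places p).1 hp
  obtain ⟨b, rfl⟩ := (Γ.mem_places q).1 hq
  have hperm : (Γ.faces.filter fun g => decide (square g = square (T, Γ.placeMask a, Γ.placeMask b))).Perm
      (([0, (Γ.placeMask a), (Γ.placeMask b), (Γ.placeMask a) ^^^ (Γ.placeMask b)].flatMap fun u => [(T ^^^ u, (Γ.placeMask a), (Γ.placeMask b)), (T ^^^ u, (Γ.placeMask b), (Γ.placeMask a))])) := by
    rw [List.perm_ext_iff_of_nodup (Γ.faces_nodup.filter _)
      (eightFaces_nodup (Γ.placeMask_ne_zero a) (Γ.placeMask_ne_zero b) (Ne.symm hqp))]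
    intro g
    rw [List.mem_filter, decide_eq_true_eq]
    constructor
    · rintro ⟨hg, h⟩
      exact (Γ.square_eq_iff_mem_eightFaces hΓ hf g hg).1 h
    · intro hg
      have hgf := Γ.eightFaces_subset_faces hΓ hf g hg
      exact ⟨hgf, (Γ.square_eq_iff_mem_eightFaces hΓ hf g hgf).2 hg⟩
  rw [hperm.length_eq, eightFaces_length]

/-- **Eight faces per square.** -/
theorem faces_length_eq_eight_mul (hΓ : Γ.isCMGaloisType = true) : Γ.faces.length = 8 * Γ.squares.length := by
  have h1 : Γ.faces.length = (Γ.faces.map square).length := by rw [List.length_map]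
  have h2 := List.sum_map_count_dedup_eq_length (Γ.faces.map square)
  have hperm : (Γ.faces.map square).dedup.Perm Γ.squares := by
    rw [List.perm_ext_iff_of_nodup (List.nodup_dedup _) Γ.squares_nodup]
    intro S
    rw [List.mem_dedup, squares, List.mem_eraseDups]
  rw [h1, ← h2, (hperm.map _).sum_eq]
  have h4 : ∀ S ∈ Γ.squares, @List.count (List ℕ) instBEqOfDecidableEq S (Γ.faces.map square) = 8 := by
    intro S hS
    obtain ⟨f, hf, rfl⟩ := (Γ.mem_squares S).1 hS
    obtain ⟨T, p, q⟩ := f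
    rw [@List.count_eq_length_filter _ instBEqOfDecidableEq, List.filter_map, List.length_map]
    exact Γ.length_filter_square_eq hΓ hf
  rw [List.map_congr_left h4, List.map_const', List.sum_replicate, smul_eq_mul, mul_comm]

/-- **Closed formula for the number of type squares.** -/
theorem squares_length_mul_eight (hΓ : Γ.isCMGaloisType = true) :
    8 * Γ.squares.length = 2 ^ (n / 2) * (n / 2 * (n / 2 - 1)) := by
  rw [← Γ.faces_length_eq_eight_mul hΓ, Γ.faces_length, Γ.cmTypes_length hΓ, Γ.places_length hΓ]

/-- **Closed formula**: `squares.length = 2 ^ (n / 2) * (n / 2 * (n / 2 - 1)) / 8` for every Cayley table with the group axioms. -/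
theorem squares_length_eq (hΓ : Γ.isCMGaloisType = true) :
    Γ.squares.length = 2 ^ (n / 2) * (n / 2 * (n / 2 - 1)) / 8 := by
  rw [← Γ.squares_length_mul_eight hΓ, Nat.mul_div_cancel_left _ (by norm_num)]

/-- Degree 6: 6 squares; degree 8: 24; degree 12: 240 — for EVERY Galois CM type of that degree. -/
theorem squares_length_six (hΓ : Γ.isCMGaloisType = true) (h : n = 6) : Γ.squares.length = 6 := by
  subst h; rw [Γ.squares_length_eq hΓ]; norm_num

/-- Degree 8: every Galois CM type has exactly `24` type squares. -/
theorem squares_length_eight (hΓ : Γ.isCMGaloisType = true) (h : n = 8) : Γ.squares.length = 24 := by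
  subst h; rw [Γ.squares_length_eq hΓ]; norm_num

/-- Degree 12: every Galois CM type has exactly `240` type squares. -/
theorem squares_length_twelve (hΓ : Γ.isCMGaloisType = true) (h : n = 12) : Γ.squares.length = 240 := by
  subst h; rw [Γ.squares_length_eq hΓ]; norm_num

end CMGaloisType

end Summit.Ventures.HodgeRepro.FaceCensus
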